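import Literature.Barriers.ResolutionOfSingularities.QuasiExcellenceNecessary
import Literature.AlgebraicGeometry.Resolution.ProperRegularModelsQuasiExcellent
import Literature.AlgebraicGeometry.Resolution.BlowupsProperProofs
import Mathlib.RingTheory.KrullDimension.Zero
import HarnessLib

/-!
# Grothendieck's theorem "resolution forces quasi-excellence" (EGA IV₂ 7.9.5): proof

`Literature/Barriers/ResolutionOfSingularities/QuasiExcellenceNecessaryProofs.lean` — sibling
proof file of `QuasiExcellenceNecessary.lean`: DISCHARGES its named fact `Grothendieck1965_7_9_5`
(Grothendieck, EGA IV₂ (7.9.5), in Temkin's rendering, 2008, §1: "if `X` is a locally noetherian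
scheme such that every integral scheme of finite type over `X` admits a resolution of
singularities, then `X` is quasi-excellent", with Temkin's blow-up notion of resolution and the
cover form of quasi-excellence) — `Grothendieck1965_7_9_5_holds`.

Proof (the classical one, EGA IV₂ §7.9): for `x ∈ X` take any affine open
neighbourhood `U = Spec C`; `C` is Noetherian, and every domain `A` of finite type over `C` gives
an integral scheme `Spec A → U ↪ X` of finite type over `X`, whence a blow-up `π : Y → Spec A`
with `Y` regular and centre missing the (regular) generic point, i.e. missing a principal open
`D(g)`, `g ≠ 0`, over which `π` is an isomorphism (`IsBlowup.isIso_morphismRestrict`) — a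
"proper regular model trivial over `D(g)`" (`hasProperRegularModels_of_admitsBlowupResolution`).
The ring-theoretic theorem `isQuasiExcellentRing_of_hasProperRegularModels`
(`Literature/AlgebraicGeometry/Resolution/ProperRegularModelsQuasiExcellent.lean`: J-2 by Nagata's
criterion, G-ring by the regularity of `Y ×_{Spec D} Spec (D_P)^` and generic formal fibres of
the quotient domains) then gives `IsQuasiExcellentRing C`.

## Sources

* M. Temkin, *Desingularization of quasi-excellent schemes in characteristic zero*, Adv. Math.
  219 (2008) 488–522 (arXiv:math/0703678), §1 p. 3 and Thm. 3.4.3 ("The converse implication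
  is due to Grothendieck, see [EGAIV]"). [Temkin2008]
* A. Grothendieck, EGA IV₂ (Publ. Math. IHÉS 24, 1965), (7.9.5). [EGAIV2]
* C. Ionescu, *Classes of Good Noetherian Rings*, Birkhäuser 2023, Prop. 4.1.24 (statement).
-/

noncomputable section

open CategoryTheory CategoryTheory.Limits AlgebraicGeometry TopologicalSpace IsLocalRing
  Literature.AlgebraicGeometry.Resolution

namespace Literature.Barriers.ResolutionOfSingularities

namespace QuasiExcellence

universe u

/-! ## From a blow-up resolution to a proper regular model trivial over `D(g)` -/

/-- The local ring of a domain at `(0)` is a regular local ring (its maximal ideal is `0`).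
[folklore] -/
theorem isRegularLocalRing_localization_bot (A : Type u) [CommRing A] [IsDomain A]
    [IsNoetherianRing A] : IsRegularLocalRing (Localization.AtPrime (⊥ : Ideal A)) := by
  apply IsRegularLocalRing.of_spanFinrank_maximalIdeal_le
  rw [← Localization.AtPrime.map_eq_maximalIdeal, Ideal.map_bot, Submodule.spanFinrank_bot]
  exact_mod_cast ringKrullDim_nonneg_of_nontrivial

/-- **A blow-up resolution of `Spec A` (`A` a Noetherian domain) is a proper regular model
trivial over a non-empty principal open `D(g)`**: the generic point is regular, hence off the
centre, so some `g ≠ 0` of the centre's ideal of global sections has `D(g)` disjoint from the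
centre; the blow-up is proper (`IsBlowup.isProper`) and an isomorphism over `D(g)`
(`IsBlowup.isIso_morphismRestrict`), through which `Spec A_g ≅ D(g)` embeds into `Y`.
[cite: Temkin2008, §1 (definition of resolution)] -/
theorem exists_model_of_admitsBlowupResolution (A : Type u) [CommRing A] [IsDomain A]
    [IsNoetherianRing A] (h : AdmitsBlowupResolution (Spec (.of A))) :
    ∃ (Y : Scheme.{u}) (π : Y ⟶ Spec (.of A)) (g : A), g ≠ 0 ∧ IsProper π ∧
      Scheme.IsRegular Y ∧ ∃ j : Spec (.of (Localization.Away g)) ⟶ Y, IsOpenImmersion j ∧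
        j ≫ π = Spec.map (CommRingCat.ofHom (algebraMap A (Localization.Away g))) := by
  obtain ⟨I, Y, π, hπ, hreg, hsupp⟩ := h
  -- the generic point is regular, hence not in the centre
  let ξ : ↥(Spec (CommRingCat.of A)) := (⟨⊥, Ideal.isPrime_bot⟩ : PrimeSpectrum A)
  have hξreg : IsRegularLocalRing ((Spec (CommRingCat.of A)).presheaf.stalk ξ) :=
    (isRegularLocalRing_stalk_Spec_iff A _).mpr (isRegularLocalRing_localization_bot A)
  have hξ : ξ ∉ I.support := hsupp ξ hξreg
  let U₀ : (Spec (CommRingCat.of A)).affineOpens := ⟨⊤, isAffineOpen_top _⟩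
  have hξ' : ¬ ∀ f ∈ (I.ideal U₀ : Set Γ(Spec (CommRingCat.of A), ⊤)),
      ξ ∉ (Spec (CommRingCat.of A)).basicOpen f := fun h' =>
    hξ ((Scheme.IdealSheafData.mem_support_iff_of_mem (U := U₀) (Opens.mem_top ξ)).mpr
      ((Scheme.mem_zeroLocus_iff _ _ ξ).mpr h'))
  simp only [not_forall, not_not, exists_prop] at hξ'
  obtain ⟨f, hfI, hξf⟩ := hξ'
  let g : A := (Scheme.ΓSpecIso (.of A)).hom f
  have hbo : (Spec (CommRingCat.of A)).basicOpen f = PrimeSpectrum.basicOpen g :=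
    basicOpen_eq_of_affine' f
  have hg0 : g ≠ 0 := by
    have h1 : ξ ∈ PrimeSpectrum.basicOpen g := by rw [← hbo]; exact hξf
    have h2 : g ∉ (⊥ : Ideal A) := (PrimeSpectrum.mem_basicOpen g ξ).mp h1
    rwa [Ideal.mem_bot] at h2
  -- `π` is an isomorphism over `D(g)`, which misses the centre
  have hdisj : Disjoint (((Spec (CommRingCat.of A)).basicOpen f :
      (Spec (CommRingCat.of A)).Opens) : Set ↥(Spec (CommRingCat.of A))) I.support := by
    rw [Set.disjoint_left]
    intro x hx hxs
    have h1 := (Scheme.IdealSheafData.mem_support_iff_of_mem (I := I) (U := U₀)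
      (Opens.mem_top x)).mp hxs
    rw [Scheme.mem_zeroLocus_iff] at h1
    exact h1 f hfI hx
  haveI hiso : IsIso (π ∣_ (Spec (CommRingCat.of A)).basicOpen f) :=
    hπ.isIso_morphismRestrict hdisj
  -- `Spec A_g ≅ D(g) ≅ π⁻¹ D(g) ↪ Y`
  let a : Spec (.of (Localization.Away g)) ⟶ Spec (CommRingCat.of A) :=
    Spec.map (CommRingCat.ofHom (algebraMap A (Localization.Away g)))
  have hrange : Set.range a ⊆ Set.range ((Spec (CommRingCat.of A)).basicOpen f).ι := by
    rw [Scheme.Opens.range_ι, hbo]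
    rintro _ ⟨y, rfl⟩
    exact (PrimeSpectrum.localization_away_comap_range (Localization.Away g) g).le ⟨y, rfl⟩
  let aU := IsOpenImmersion.lift ((Spec (CommRingCat.of A)).basicOpen f).ι a hrange
  have haU : aU ≫ ((Spec (CommRingCat.of A)).basicOpen f).ι = a := IsOpenImmersion.lift_fac _ _ _
  haveI : IsOpenImmersion aU := by
    haveI : IsOpenImmersion (aU ≫ ((Spec (CommRingCat.of A)).basicOpen f).ι) := by
      rw [haU]; infer_instance
    exact IsOpenImmersion.of_comp aU ((Spec (CommRingCat.of A)).basicOpen f).ι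
  let j : Spec (.of (Localization.Away g)) ⟶ Y :=
    aU ≫ inv (π ∣_ (Spec (CommRingCat.of A)).basicOpen f) ≫
      (π ⁻¹ᵁ (Spec (CommRingCat.of A)).basicOpen f).ι
  refine ⟨Y, π, g, hg0, hπ.isProper, hreg, j, inferInstance, ?_⟩
  change (aU ≫ inv (π ∣_ (Spec (CommRingCat.of A)).basicOpen f) ≫
      (π ⁻¹ᵁ (Spec (CommRingCat.of A)).basicOpen f).ι) ≫ π = a
  rw [Category.assoc, Category.assoc, ← morphismRestrict_ι, IsIso.inv_hom_id_assoc, haU]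

/-- `HasProperRegularModels C` from blow-up resolutions of all integral affine schemes of finite
type over `C`. [cite: Temkin2008, §1] -/
theorem hasProperRegularModels_of_admitsBlowupResolution (C : Type u) [CommRing C]
    [IsNoetherianRing C]
    (h : ∀ (A : Type u) [CommRing A] [IsDomain A] [Algebra C A], Algebra.FiniteType C A →
      AdmitsBlowupResolution (Spec (.of A))) :
    HasProperRegularModels C := by
  intro A _ _ _ hA
  haveI : IsNoetherianRing A := Algebra.FiniteType.isNoetherianRing C A
  exact exists_model_of_admitsBlowupResolution A (h A hA)

/-! ## From the scheme hypothesis to the affine opens -/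

/-- Under the hypothesis of Grothendieck's theorem, every integral affine scheme of finite type
over the coordinate ring of an affine open `U ⊆ X` admits a blow-up resolution: `Spec A → U ↪ X`
is locally of finite type and quasi-compact (an open immersion into a locally Noetherian scheme is
quasi-compact). [folklore] -/
theorem admitsBlowupResolution_of_affineOpen {X : Scheme.{u}} [IsLocallyNoetherian X]
    (H : ∀ (Y : Scheme.{u}) (f : Y ⟶ X), IsIntegral Y → LocallyOfFiniteType f → QuasiCompact f →
      AdmitsBlowupResolution Y)
    (U : X.affineOpens) (A : Type u) [CommRing A] [IsDomain A] [Algebra Γ(X, U) A]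
    (hA : Algebra.FiniteType Γ(X, U) A) : AdmitsBlowupResolution (Spec (.of A)) := by
  let f : Spec (.of A) ⟶ X := Spec.map (CommRingCat.ofHom (algebraMap Γ(X, U) A)) ≫ U.2.fromSpec
  haveI : LocallyOfFiniteType (Spec.map (CommRingCat.ofHom (algebraMap Γ(X, U) A))) :=
    (HasRingHomProperty.Spec_iff (P := @LocallyOfFiniteType)).mpr
      (RingHom.finiteType_algebraMap.mpr hA)
  haveI : LocallyOfFiniteType f := inferInstance
  haveI : QuasiCompact f := inferInstance
  exact H _ f inferInstance inferInstance inferInstance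

/-! ## The theorem -/

/-- DISCHARGE of the named fact `Grothendieck1965_7_9_5` — **Grothendieck, EGA IV₂ (7.9.5), as
printed by Temkin (2008, §1)**: a locally Noetherian scheme over which every integral scheme of
finite type admits a (blow-up) resolution of singularities is quasi-excellent (covered by spectra
of quasi-excellent rings; in fact EVERY affine open has a quasi-excellent coordinate ring). For
`x ∈ X` and an affine open neighbourhood `U = Spec C`: `C` is Noetherian and every integral
affine `C`-scheme of finite type has a proper regular model trivial over a dense principal open
(`hasProperRegularModels_of_admitsBlowupResolution`), so `C` is quasi-excellent by
`isQuasiExcellentRing_of_hasProperRegularModels` (J-2: Nagata's criterion, Matsumura Thm. 24.4;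
G-ring: flatness of completion, Stacks 07PN, and the regularity of `Y ×_{Spec D} Spec (D_P)^`
for a proper regular `Y → Spec D`, EGA IV₂ §7.9). [cite: Temkin2008, §1 and Thm. 3.4.3]
[cite: EGAIV2, (7.9.5)] -/
theorem Grothendieck1965_7_9_5_holds : Grothendieck1965_7_9_5.{u} := by
  intro X hX H x
  obtain ⟨U, hU, hxU, -⟩ :=
    exists_isAffineOpen_mem_and_subset (X := X) (x := x) (U := ⊤) (Opens.mem_top x)
  haveI : IsNoetherianRing Γ(X, U) := IsLocallyNoetherian.component_noetherian ⟨U, hU⟩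
  refine ⟨⟨U, hU⟩, hxU, isQuasiExcellentRing_of_hasProperRegularModels Γ(X, U)
    (hasProperRegularModels_of_admitsBlowupResolution Γ(X, U) fun A _ _ _ hA =>
      admitsBlowupResolution_of_affineOpen H ⟨U, hU⟩ A hA)⟩

/-- **The stronger all-affine-opens form, PROVED**: under the hypothesis of
`Grothendieck1965_7_9_5`, EVERY affine open of `X` has a quasi-excellent coordinate ring, i.e.
`X` is quasi-excellent in the sense of the tree's `Scheme.IsQuasiExcellent` (the conclusion of
EGA IV₂ (7.9.5) is that `X` is quasi-excellent; Temkin prints the cover form).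
[cite: EGAIV2, (7.9.5)] -/
theorem isQuasiExcellent_of_admitsBlowupResolution {X : Scheme.{u}} [IsLocallyNoetherian X]
    (H : ∀ (Y : Scheme.{u}) (f : Y ⟶ X), IsIntegral Y → LocallyOfFiniteType f → QuasiCompact f →
      AdmitsBlowupResolution Y) :
    Literature.AlgebraicGeometry.Resolution.Scheme.IsQuasiExcellent X := fun U => by
  haveI : IsNoetherianRing Γ(X, U) := IsLocallyNoetherian.component_noetherian U
  exact isQuasiExcellentRing_of_hasProperRegularModels Γ(X, U)
    (hasProperRegularModels_of_admitsBlowupResolution Γ(X, U) fun A _ _ _ hA =>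
      admitsBlowupResolution_of_affineOpen H U A hA)

end QuasiExcellence

end Literature.Barriers.ResolutionOfSingularities

end
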